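import Mathlib.Analysis.Complex.LocallyUniformLimit
import Summits.QuantumFields.BalabanUV.T4Continuum.Spine.NE4.FadingFromRateRealAnalytic

/-!
# Spine/NE4/FadingFromRateLocalAnalytic — the (R37) rung with hypotheses on the REAL β-functions ONLY: real-analyticity of the one-coupling
# sections with uniform constants (local holomorphic charts, or a uniform TAYLOR MAJORANT) — no posited complex history family, no `ExtendsC`

Cell `pub-balaban-gaps` (YM blitz G2), seat `ne4`, generation 7 (unit `pub-balaban-gaps-ne4-g7`); record `HOME/ne/NE4.md` §5 census item
(R39).  Sequel of `Spine/NE4/FadingFromRateRealAnalytic` (g6, (R37): REAL NE4 `ScaleShiftRate c θ γ β` + `ExtendsC β βc` + `CoordAnalyticC B γ r βc`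
⟹ `HistLipschitz Λ₂ γ β ∧ ∀ θ′ > θ, FadingMemory C₂(θ′) θ′ Λ₂`, `Λ₂ k i = K₂θ^{k−i}(1 + (k−i)log(1∕θ))²`), whose header — like g5's (R34) —
records the caveat «WHAT IS NOT CLAIMED. That Bałaban's `β_{j+1}` admit complex couplings»: both files POSIT a complex history family
`βc : HBetaC` on the whole complex `r`-neighbourhood of the coupling boxes.

THE POINT.  No such object is needed.  The two-constants engine of (R37) (`TwoConstantsFold.norm_deriv_le_of_oneSided_right∕left`) is LOCAL:
at a real coupling `x` it uses a holomorphic function on a disc about `x` that is bounded there and agrees with the real section on a real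
slit.  So the honest hypothesis is a statement about the REAL family `β` alone — **`LocalAnalytic B γ r β`** (§1): for every scale `k`,
real box history `p`, coordinate `i` and real coupling `x ∈ ]0,γ]`, SOME function holomorphic on the open disc of radius `r` about `x`,
bounded by `B` there, agrees with the real one-coupling section `t ↦ β_{k+1}(p; g_i := t)` at the real box points `t` with `|t − x| < r`.
This is exactly «`β_{k+1}` is real-analytic in each coupling on `[0, γ]`, with radius and bound uniform in `k`, `i`, `p`» — [Balaban1987RG1]
p. 264 *"It is a smooth function defined on the interval [0, γ], (or analytic), uniformly bounded on this interval together with all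
derivatives"* made uniform in the scale and coupling index (uniformity in `k` unprinted, GAPS G-adv2-3; everything for `i < k` unprinted,
G-t4-U2-2) — and a real-analytic function ALWAYS has such local charts: nothing about «complex couplings» is assumed any more.  §2 gives the
purely real, chart-free supplier **`TaylorMajorant B γ r β`**: at every real box point the section is the sum of its real power series with
the uniform Cauchy majorant `|a_n|·rⁿ ≤ B` (⟹ `LocalAnalytic (2B) γ (r∕2) β`, the chart being the complex power series, holomorphic by
Mathlib's `Complex.differentiableOn_tsum_of_summable_norm`); §1 also shows g6's pair {`ExtendsC`, `CoordAnalyticC B γ r`} ⟹ `LocalAnalytic B γ r`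
(`localAnalytic_of_coordAnalyticC`), so this file's headline IMPLIES (R37)'s up to `r ↦ r∕2` in the constants.  §3 re-runs (R37)'s §3 chart
by chart: NE4's oscillation cap along the real box (`abs_sub_le_of_agree_young'`), the `2B` bound on the disc of radius `s = min(r∕2, γ∕2)`
about `x` (inside the chart's disc of radius `r`), the one-sided two-constants bound at `x`, and — the one new step — the real section
`u ↦ β_{k+1}(p; g_i := u)` has derivative `Φ_x′(x)` WITHIN `]0,γ]` at `x` because it agrees with the chart near `x`
(`HasDerivWithinAt.congr_of_eventuallyEq`), so the mean value inequality runs along the real interval with ONE real function and a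
different chart at each point: `|β_{k+1}(p; g_i := t) − β_{k+1}(p)| ≤ Λ₂ k i·|t − p_i|` with `Λ₂ = realAnalyticModuli c θ B (r∕2) γ`
(`abs_sub_update_le_of_localAnalytic`).  §4: the headline `histLipschitz_fadingMemory_of_localAnalytic` (every `θ′ > θ`, loss `age²`, as (R37));
§5: node U2 (β-generic `disc_le_of_localAnalytic`, data faces `u2Inputs_of_localAnalytic`, `u2Output_under_of_localAnalytic`, upstream
`u2Inputs_of_ne5_localAnalytic`, END TO END `u2Output_under_of_ne5_localAnalytic`), and the Taylor face `histLipschitz_fadingMemory_of_taylorMajorant`.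

RESULT FOR THE ROW (NE4.md (R39)): node U2's β-side input list, FIFTH and leanest typed form — {NE4 EXACTLY as the spine types it, real-
analyticity of the REAL one-coupling sections with uniform `(B, r)`} ⟹ node U2's whole triple and its geometric K-uniform output at any
`θ′ ∈ ]θ,1[` (two radii, constants of (R37) with `r ↦ r∕2`); the complex family `βc`, `ExtendsC` and the «complex couplings» caveat of
(R34)∕(R37) are GONE from the hypothesis list; what stays unprinted is only the UNIFORMITY of p. 264's clause in `(k, i)`.

WHAT IS NOT CLAIMED.  Any uniformity in `j` of p. 264's clause, any regularity in the earlier couplings, NE4 itself: `LocalAnalytic`,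
`TaylorMajorant` and NE4 are HYPOTHESIS SHAPES, UNPRINTED; `B > 0` assumed.  HONEST FRAMING: bookkeeping + elementary complex analysis over
hypothesis shapes on an ABSTRACT family; nothing of Bałaban's asserted beyond print; NE4 NOT IN PRINT, NOT PROVED; binders 0∕6, spine PROVED
0∕9 unchanged; NOT the continuum limit on ℝ⁴, NOT infinite volume, NOT a mass gap, NOT Clay.  HONEST DEPENDENCY: continuum YM on T⁴ ⇐
BetaPertH ∧ nine spine estimates (0∕9 proved).  0 sorry; axioms standard; imports `Spine/NE4/FadingFromRateRealAnalytic` + Mathlib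
`Analysis.Complex.LocallyUniformLimit`; modifies nothing.
Reference (TYPES only): [Balaban1987RG1] = T. Bałaban, Commun. Math. Phys. **109** (1987) 249–301, (0.20) p. 256, §1 p. 264, p. 298.
-/

noncomputable section

namespace Summit.QuantumFields.BalabanUV.T4Continuum.Spine.NE4

open Set Metric Filter Topology
open Literature.MathematicalPhysics.QuantumFieldTheory.Balaban1983to89
open Literature.MathematicalPhysics.QuantumFieldTheory.Balaban1983to89.FlowStep
open Literature.MathematicalPhysics.QuantumFieldTheory.Balaban1983to89.T4CouplingMatching
open Literature.MathematicalPhysics.QuantumFieldTheory.Balaban1983to89.T4Continuum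

universe u

/-! ## §1 The shape on the REAL family: local holomorphic charts of the one-coupling sections, uniform `(B, r)` -/

/-- [shape] HYPOTHESIS SHAPE — **LOCAL ANALYTICITY OF THE REAL ONE-COUPLING SECTIONS, UNIFORM CONSTANTS**: for every scale `k`, every
real box history `p ∈ ]0,γ]^{k+1}`, every coordinate `i ≤ k` and every real coupling `x ∈ ]0,γ]` there is a function `Φ` holomorphic on the
open disc of radius `r` about `x`, bounded by `B` on that disc, with `Φ(t) = β_{k+1}(p; g_i := t)` for the real `t ∈ ]0,γ]` with `|t − x| < r`
— i.e. the real section is real-analytic on the coupling interval with radius `r` and bound `B` uniform in `k`, `i`, `p`, `x`.  Printed TYPE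
for `i = k` ([Balaban1987RG1] p. 264 *"(or analytic), uniformly bounded"*; uniformity in `k` unprinted, GAPS G-adv2-3), UNPRINTED for
`i < k` (G-t4-U2-2); NO complex history family is posited; NO decay content.  A parametric proposition — NOT a fact. [folklore] -/
def LocalAnalytic (B γ r : ℝ) (β : HBeta) : Prop :=
  ∀ k (p : Fin (k + 1) → ℝ), p ∈ Box γ k → ∀ (i : Fin (k + 1)) (x : ℝ), x ∈ Ioc (0 : ℝ) γ →
    ∃ Φ : ℂ → ℂ, DifferentiableOn ℂ Φ (ball (x : ℂ) r) ∧ (∀ z ∈ ball (x : ℂ) r, ‖Φ z‖ ≤ B) ∧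
      ∀ t ∈ Ioc (0 : ℝ) γ, |t - x| < r → Φ (t : ℂ) = (β k (Function.update p i t) : ℂ)

/-- [bookkeeping] **THE UNIFORM BOUND IS INSIDE THE SHAPE**: `LocalAnalytic B γ r β` (`r > 0`) gives `|β_{k+1}| ≤ B` on the boxes (the chart
about `x = p_0` at its own centre). [folklore] -/
theorem bound_of_localAnalytic {β : HBeta} {B γ r : ℝ} (hL : LocalAnalytic B γ r β) (hr : 0 < r) :
    ∀ k (v : Fin (k + 1) → ℝ), v ∈ Box γ k → |β k v| ≤ B := by
  intro k v hv
  have h0 : v 0 ∈ Ioc (0 : ℝ) γ := (mem_box.mp hv) 0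
  obtain ⟨Φ, -, hbnd, hagree⟩ := hL k v hv 0 (v 0) h0
  have h := hbnd (v 0 : ℂ) (mem_ball_self hr)
  rw [hagree (v 0) h0 (by simpa using hr), Function.update_eq_self, Complex.norm_real, Real.norm_eq_abs] at h
  exact h

/-- [bookkeeping] **g6's PAIR IMPLIES THE SHAPE**: a complex extension `βc` of `β` (`ExtendsC`) with `CoordAnalyticC B γ r βc` gives
`LocalAnalytic B γ r β` — the chart at every `x` is the global complex section itself (its open disc of radius `r` about a box point lies in
`Nbhd r γ`).  So this file's headline implies (R37)'s, up to `r ↦ r∕2` in the constants. [folklore] -/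
theorem localAnalytic_of_coordAnalyticC {β : HBeta} {βc : HBetaC} {B γ r : ℝ} (hE : ExtendsC β βc)
    (hA : CoordAnalyticC B γ r βc) : LocalAnalytic B γ r β := by
  intro k p hp i x hx
  obtain ⟨U, -, hUsub, hdiff, hbnd⟩ := hA k p hp i
  have hball : ball (x : ℂ) r ⊆ Nbhd r γ := fun z hz => mem_nbhd_of_mem_closedBall hx (ball_subset_closedBall hz)
  refine ⟨fun z => βc k (Function.update (fun j => (p j : ℂ)) i z), hdiff.mono (hball.trans hUsub),
    fun z hz => hbnd z (hball hz), fun t _ _ => ?_⟩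
  show βc k (Function.update (fun j => (p j : ℂ)) i (t : ℂ)) = (β k (Function.update p i t) : ℂ)
  rw [← hE k (Function.update p i t)]
  congr 1; funext j
  exact (Function.apply_update (fun _ (y : ℝ) => (y : ℂ)) p i t j).symm

/-! ## §2 The chart-free real supplier: a uniform TAYLOR MAJORANT -/

/-- [shape] HYPOTHESIS SHAPE — **UNIFORM TAYLOR MAJORANT** (purely real, no chart): for every `k`, real box history `p`, coordinate `i` and
real coupling `x ∈ ]0,γ]` there are real coefficients `a_n` with the Cauchy majorant `|a_n|·rⁿ ≤ B` (all `n`) such that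
`β_{k+1}(p; g_i := t) = Σ_n a_n (t − x)ⁿ` for the real `t ∈ ]0,γ]` with `|t − x| < r` — the quantitative content of «analytic on `[0,γ]`,
uniformly bounded together with all derivatives» ([Balaban1987RG1] p. 264, last coupling; Cauchy's estimates make the derivative bounds
`n!·B∕rⁿ`).  UNPRINTED uniformity in `k` (G-adv2-3) and everything for `i < k` (G-t4-U2-2).  NOT a fact. [folklore] -/
def TaylorMajorant (B γ r : ℝ) (β : HBeta) : Prop :=
  ∀ k (p : Fin (k + 1) → ℝ), p ∈ Box γ k → ∀ (i : Fin (k + 1)) (x : ℝ), x ∈ Ioc (0 : ℝ) γ →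
    ∃ a : ℕ → ℝ, (∀ n, |a n| * r ^ n ≤ B) ∧
      ∀ t ∈ Ioc (0 : ℝ) γ, |t - x| < r → HasSum (fun n => a n * (t - x) ^ n) (β k (Function.update p i t))

/-- **A TAYLOR MAJORANT GIVES THE CHARTS**: `TaylorMajorant B γ r β` (`r > 0`) ⟹ `LocalAnalytic (2B) γ (r∕2) β` — the chart at `x`
is the complex power series `Σ a_n (z − x)ⁿ`, holomorphic on the disc of radius `r∕2` (terms bounded by the summable `B·2^{−n}` there,
`Complex.differentiableOn_tsum_of_summable_norm`), bounded by `2B`, and equal to the real sum at real points. [folklore] -/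
theorem localAnalytic_of_taylorMajorant {β : HBeta} {B γ r : ℝ} (hT : TaylorMajorant B γ r β) (hr : 0 < r) :
    LocalAnalytic (2 * B) γ (r / 2) β := by
  intro k p hp i x hx
  obtain ⟨a, ha, hsum⟩ := hT k p hp i x hx
  let F : ℕ → ℂ → ℂ := fun n z => (a n : ℂ) * (z - (x : ℂ)) ^ n
  have hFdiff : ∀ n, DifferentiableOn ℂ (F n) (ball (x : ℂ) (r / 2)) := fun n =>
    ((differentiable_const (a n : ℂ)).mul ((differentiable_id.sub_const (x : ℂ)).pow n)).differentiableOn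
  have hq0 : (0 : ℝ) ≤ 1 / 2 := by norm_num
  have hq1 : (1 / 2 : ℝ) < 1 := by norm_num
  have hgeomS : Summable (fun n : ℕ => B * (1 / 2 : ℝ) ^ n) := (summable_geometric_of_lt_one hq0 hq1).mul_left B
  have hgeomH : HasSum (fun n : ℕ => B * (1 / 2 : ℝ) ^ n) (2 * B) := by
    have h := (hasSum_geometric_of_lt_one hq0 hq1).mul_left B
    have e : B * (1 - 1 / 2)⁻¹ = 2 * B := by norm_num; ring
    rwa [e] at h
  have hFle : ∀ n (z : ℂ), z ∈ ball (x : ℂ) (r / 2) → ‖F n z‖ ≤ B * (1 / 2 : ℝ) ^ n := by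
    intro n z hz
    have hzx : ‖z - (x : ℂ)‖ ≤ r / 2 := (mem_ball_iff_norm.mp hz).le
    have hpow : ‖z - (x : ℂ)‖ ^ n ≤ (r / 2) ^ n := pow_le_pow_left₀ (norm_nonneg _) hzx n
    calc ‖F n z‖ = |a n| * ‖z - (x : ℂ)‖ ^ n := by
          simp only [F, norm_mul, norm_pow, Complex.norm_real, Real.norm_eq_abs]
      _ ≤ |a n| * (r / 2) ^ n := mul_le_mul_of_nonneg_left hpow (abs_nonneg _)
      _ = |a n| * r ^ n * (1 / 2 : ℝ) ^ n := by rw [div_eq_mul_one_div, mul_pow]; ring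
      _ ≤ B * (1 / 2 : ℝ) ^ n := mul_le_mul_of_nonneg_right (ha n) (pow_nonneg hq0 n)
  refine ⟨fun z => ∑' n, F n z, Complex.differentiableOn_tsum_of_summable_norm hgeomS hFdiff isOpen_ball hFle,
    fun z hz => tsum_of_norm_bounded hgeomH fun n => hFle n z hz, fun t ht htx => ?_⟩
  have htx' : |t - x| < r := htx.trans (by linarith)
  have hC : HasSum (fun n => ((a n * (t - x) ^ n : ℝ) : ℂ)) ((β k (Function.update p i t) : ℝ) : ℂ) :=
    Complex.hasSum_ofReal.mpr (hsum t ht htx')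
  have e : (fun n => F n (t : ℂ)) = fun n => ((a n * (t - x) ^ n : ℝ) : ℂ) := funext fun n => by
    simp only [F]; push_cast; ring
  show ∑' n, F n (t : ℂ) = _
  rw [e]; exact hC.tsum_eq

/-! ## §3 Real NE4 + local analyticity: coordinatewise Lipschitz moduli `K₂·θ^{age}·(1 + age·log(1∕θ))²` with `K₂ = 2e³E₀∕min(r∕2, γ∕2)` -/

/-- **COORDINATEWISE LIPSCHITZ FROM THE REAL NE4 + LOCAL ANALYTICITY** (the chart-by-chart re-run of `abs_sub_update_le_of_realAnalytic`).
Under the REAL `ScaleShiftRate c θ γ β` (`c ≥ 0`, `0 < θ < 1`) and `LocalAnalytic B γ r β` (`B, r, γ > 0`): changing the ONE coupling `g_i` of a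
real history in `]0,γ]^{k+1}` within `]0,γ]` moves `β_{k+1}` by at most `Λ₂ k i·|Δg_i|`, `Λ₂ = realAnalyticModuli c θ B (r∕2) γ` — i.e.
`K₂·θ^{a}·(1 + a·log(1∕θ))²`, `a = k − i`, `K₂ = 2e³E₀∕min(r∕2, γ∕2)`, `E₀ = oscConst c θ B`.  At each real coupling `x` the chart `Φ_x` is
`2B`-oscillation-bounded on the disc of radius `s = min(r∕2, γ∕2)` and `ε = E₀θ^a`-close to `Φ_x(x)` along the real slit inside the box (NE4's
oscillation cap `abs_sub_le_of_agree_young'`), so the one-sided two-constants bound caps `‖Φ_x′(x)‖`; the real section has that derivative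
WITHIN `]0,γ]` at `x` (it agrees with the chart near `x`), and the mean value inequality along the interval concludes. [folklore] -/
theorem abs_sub_update_le_of_localAnalytic {β : HBeta} {c θ γ r B : ℝ} (hL : LocalAnalytic B γ r β)
    (hS : ScaleShiftRate c θ γ β) (hc : 0 ≤ c) (hθ0 : 0 < θ) (hθ1 : θ < 1) (hB : 0 < B) (hr : 0 < r) (hγ : 0 < γ)
    {k : ℕ} {p : Fin (k + 1) → ℝ} (hp : p ∈ Box γ k) (i : Fin (k + 1)) {t : ℝ} (ht : t ∈ Ioc (0 : ℝ) γ) :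
    |β k (Function.update p i t) - β k p| ≤ realAnalyticModuli c θ B (r / 2) γ k i * |t - p i| := by
  have hbound := bound_of_localAnalytic hL hr
  set a : ℕ := k - (i : ℕ) with ha
  set E₀ : ℝ := oscConst c θ B with hE₀
  have hE₀B : 2 * B ≤ E₀ := le_max_left _ _
  have hE₀pos : 0 < E₀ := lt_of_lt_of_le (by linarith) hE₀B
  set ε : ℝ := E₀ * θ ^ a with hε
  have hεpos : 0 < ε := mul_pos hE₀pos (pow_pos hθ0 a)
  set M : ℝ := max (2 * B) ε with hM
  have hεM : ε ≤ M := le_max_right _ _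
  set s : ℝ := slitLen (r / 2) γ with hs_def
  have hs : 0 < s := slitLen_pos (by linarith) hγ
  have hsr : s ≤ r / 2 := min_le_left _ _
  have hsγ : s ≤ γ / 2 := min_le_right _ _
  have hsr' : s < r := by linarith
  -- the REAL one-coupling section through `p` in coordinate `i`, as a `ℂ`-valued function of the real coupling
  let g : ℝ → ℂ := fun u => (β k (Function.update p i u) : ℂ)
  have hbox : ∀ u ∈ Ioc (0 : ℝ) γ, Function.update p i u ∈ Box γ k := fun u hu => by
    rw [mem_box] at hp ⊢
    intro j; by_cases hj : j = i
    · subst hj; simpa using hu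
    · rw [Function.update_of_ne hj]; exact hp j
  -- NE4's oscillation cap along the REAL box
  have hosc : ∀ u ∈ Ioc (0 : ℝ) γ, ∀ u' ∈ Ioc (0 : ℝ) γ, ‖g u - g u'‖ ≤ ε := by
    intro u hu u' hu'
    change ‖(β k (Function.update p i u) : ℂ) - (β k (Function.update p i u') : ℂ)‖ ≤ ε
    rw [← Complex.ofReal_sub, Complex.norm_real, Real.norm_eq_abs]
    refine abs_sub_le_of_agree_young' hS hc hθ0 hθ1 hbound (Nat.lt_succ_iff.mp i.isLt) (hbox u hu) (hbox u' hu')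
      fun j hj => ?_
    have hji : j ≠ i := fun h => by subst h; exact lt_irrefl _ hj
    rw [Function.update_of_ne hji, Function.update_of_ne hji]
  -- the logarithm: `max(1, log(M/ε)) ≤ 1 + a·log(1/θ)` since `2B ≤ E₀`
  have hlog : Real.log (M / ε) ≤ (a : ℝ) * (-Real.log θ) := by
    rcases le_or_gt (2 * B) ε with h | h
    · rw [show M = ε from max_eq_right h, div_self hεpos.ne', Real.log_one]
      exact mul_nonneg (Nat.cast_nonneg a) (by have := Real.log_neg hθ0 hθ1; linarith)
    · have hq : M / ε ≤ (θ ^ a)⁻¹ := by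
        rw [show M = 2 * B from max_eq_left h.le, div_le_iff₀ hεpos, hε]
        calc 2 * B ≤ E₀ := hE₀B
          _ = (θ ^ a)⁻¹ * (E₀ * θ ^ a) := by field_simp
      calc Real.log (M / ε) ≤ Real.log ((θ ^ a)⁻¹) := Real.log_le_log (div_pos (by linarith) hεpos) hq
        _ = (a : ℝ) * (-Real.log θ) := by rw [Real.log_inv, Real.log_pow]; ring
  have hL1 : max 1 (Real.log (M / ε)) ≤ 1 + (a : ℝ) * (-Real.log θ) :=
    max_le (le_add_of_nonneg_right (mul_nonneg (Nat.cast_nonneg a)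
      (by have := Real.log_neg hθ0 hθ1; linarith))) (by linarith)
  have hL2 : max 1 (Real.log (M / ε)) ^ 2 ≤ (1 + (a : ℝ) * (-Real.log θ)) ^ 2 :=
    pow_le_pow_left₀ (zero_le_one.trans (le_max_left _ _)) hL1 2
  have hfold : 2 * Real.exp 3 * ε * max 1 (Real.log (M / ε)) ^ 2 / s ≤ realAnalyticModuli c θ B (r / 2) γ k i := by
    show 2 * Real.exp 3 * ε * max 1 (Real.log (M / ε)) ^ 2 / s ≤
      2 * Real.exp 3 * E₀ / s * θ ^ a * (1 + (a : ℝ) * (-Real.log θ)) ^ 2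
    have h2e : 0 ≤ 2 * Real.exp 3 * ε / s := by positivity
    calc 2 * Real.exp 3 * ε * max 1 (Real.log (M / ε)) ^ 2 / s
        = 2 * Real.exp 3 * ε / s * max 1 (Real.log (M / ε)) ^ 2 := by ring
      _ ≤ 2 * Real.exp 3 * ε / s * (1 + (a : ℝ) * (-Real.log θ)) ^ 2 := mul_le_mul_of_nonneg_left hL2 h2e
      _ = 2 * Real.exp 3 * E₀ / s * θ ^ a * (1 + (a : ℝ) * (-Real.log θ)) ^ 2 := by rw [hε]; ring
  -- chart by chart: the real section has a derivative WITHIN the interval at every real coupling, bounded by the two-constants bound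
  have hderiv : ∀ x ∈ Ioc (0 : ℝ) γ, ∃ φ' : ℂ, HasDerivWithinAt g φ' (Ioc (0 : ℝ) γ) x ∧
      ‖φ'‖ ≤ realAnalyticModuli c θ B (r / 2) γ k i := by
    intro x hx
    obtain ⟨Φ, hdiff, hbnd, hagree⟩ := hL k p hp i x hx
    have hballU : closedBall (x : ℂ) s ⊆ ball (x : ℂ) r := closedBall_subset_ball hsr'
    have hΦx : Φ (x : ℂ) = g x := hagree x hx (by simpa using hr)
    have hΦreal : ∀ u ∈ Ioc (0 : ℝ) γ, |u - x| ≤ s → Φ (u : ℂ) = g u := fun u hu hus =>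
      hagree u hu (lt_of_le_of_lt hus hsr')
    have hMdisc : ∀ z ∈ closedBall (x : ℂ) s, ‖Φ z - Φ x‖ ≤ M := fun z hz =>
      calc ‖Φ z - Φ x‖ ≤ ‖Φ z‖ + ‖Φ x‖ := norm_sub_le _ _
        _ ≤ B + B := add_le_add (hbnd z (hballU hz)) (hbnd (x : ℂ) (mem_ball_self hr))
        _ = 2 * B := by ring
        _ ≤ M := le_max_left _ _
    have hd : ‖deriv Φ (x : ℂ)‖ ≤ 2 * Real.exp 3 * ε * max 1 (Real.log (M / ε)) ^ 2 / s := by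
      rcases le_or_gt x (γ / 2) with hxr | hxl
      · refine norm_deriv_le_of_oneSided_right hs hεpos hεM isOpen_ball hballU hdiff hMdisc fun u hxu hus => ?_
        have hu : u ∈ Ioc (0 : ℝ) γ := ⟨hx.1.trans_le hxu, hus.trans (by linarith)⟩
        rw [hΦreal u hu (by rw [abs_of_nonneg (by linarith)]; linarith), hΦx]
        exact hosc u hu x hx
      · refine norm_deriv_le_of_oneSided_left hs hεpos hεM isOpen_ball hballU hdiff hMdisc fun u hsu hux => ?_
        have hu : u ∈ Ioc (0 : ℝ) γ := ⟨by linarith, hux.trans hx.2⟩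
        rw [hΦreal u hu (by rw [abs_of_nonpos (by linarith)]; linarith), hΦx]
        exact hosc u hu x hx
    have hΦat : HasDerivAt (fun u : ℝ => Φ (u : ℂ)) (deriv Φ (x : ℂ)) x :=
      (hdiff.differentiableAt (isOpen_ball.mem_nhds (mem_ball_self hr))).hasDerivAt.comp_ofReal
    have hcongr : g =ᶠ[𝓝[Ioc (0 : ℝ) γ] x] fun u : ℝ => Φ (u : ℂ) := by
      have hnhd : Ioc (0 : ℝ) γ ∩ Ioo (x - s) (x + s) ∈ 𝓝[Ioc (0 : ℝ) γ] x :=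
        inter_mem_nhdsWithin _ (Ioo_mem_nhds (show x - s < x by linarith) (show x < x + s by linarith))
      filter_upwards [hnhd] with u hu
      exact (hΦreal u hu.1 (abs_sub_lt_iff.mpr ⟨by linarith [hu.2.2], by linarith [hu.2.1]⟩).le).symm
    exact ⟨deriv Φ (x : ℂ), hΦat.hasDerivWithinAt.congr_of_eventuallyEq hcongr hΦx.symm, hd.trans hfold⟩
  choose! φ' hφ' using hderiv
  -- mean value inequality along the real coupling interval, ONE real function, a chart per point
  have hmvt := (convex_Ioc (0 : ℝ) γ).norm_image_sub_le_of_norm_hasDerivWithin_le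
    (fun x hx => (hφ' x hx).1) (fun x hx => (hφ' x hx).2) ((mem_box.mp hp) i) ht
  have h2 : g (p i) = (β k p : ℂ) := by
    change (β k (Function.update p i (p i)) : ℂ) = _; rw [Function.update_eq_self]
  rw [h2] at hmvt
  change ‖(β k (Function.update p i t) : ℂ) - (β k p : ℂ)‖ ≤ _ at hmvt
  rw [← Complex.ofReal_sub, Complex.norm_real, Real.norm_eq_abs, Real.norm_eq_abs] at hmvt
  exact hmvt

/-! ## §4 The headline: `HistLipschitz` and `FadingMemory` at every rate `θ′ > θ`, from the REAL family alone -/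

/-- **HEADLINE — FADING MEMORY FROM THE REAL NE4 + REAL-ANALYTICITY OF THE REAL SECTIONS, AT EVERY RATE `θ′ > θ`.**  Under the REAL
`ScaleShiftRate c θ γ β` (`c ≥ 0`, `0 < θ < 1`) and `LocalAnalytic B γ r β` (`B, r, γ > 0`): `HistLipschitz Λ₂ γ β` and
`∀ θ′ > θ, FadingMemory C₂(θ′) θ′ Λ₂` with `Λ₂ = realAnalyticModuli c θ B (r∕2) γ`, `C₂(θ′) = realAnalyticFading c θ B (r∕2) γ θ′` — (R37)'s
conclusion with `r ↦ r∕2`, WITHOUT a complex history family (`HBetaC`), WITHOUT `ExtendsC`, WITHOUT `CoordAnalyticC`. [folklore] -/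
theorem histLipschitz_fadingMemory_of_localAnalytic {β : HBeta} {c θ γ r B : ℝ} (hL : LocalAnalytic B γ r β)
    (hS : ScaleShiftRate c θ γ β) (hc : 0 ≤ c) (hθ0 : 0 < θ) (hθ1 : θ < 1) (hB : 0 < B) (hr : 0 < r) (hγ : 0 < γ) :
    HistLipschitz (realAnalyticModuli c θ B (r / 2) γ) γ β ∧
      ∀ θ', θ < θ' → FadingMemory (realAnalyticFading c θ B (r / 2) γ θ') θ' (realAnalyticModuli c θ B (r / 2) γ) := by
  have hr2 : 0 < r / 2 := by linarith
  refine ⟨histLipschitz_of_coordModuli fun k p hp i t ht =>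
      abs_sub_update_le_of_localAnalytic hL hS hc hθ0 hθ1 hB hr hγ hp i ht, fun θ' hθθ' k i _ => ⟨?_, ?_⟩⟩
  · exact realAnalyticModuli_nonneg hc hθ0 hθ1 hr2 hγ k i
  · have hK := realAnalyticConst_nonneg (B := B) hc hθ0 hθ1 hr2 hγ
    have key := pow_mul_sq_le_pow hθ0 hθ1 hθθ' (k - i)
    show realAnalyticConst c θ B (r / 2) γ * θ ^ (k - i) * (1 + ((k - i : ℕ) : ℝ) * (-Real.log θ)) ^ 2 ≤
      realAnalyticConst c θ B (r / 2) γ * max 1 (2 * (-Real.log θ) / Real.log (θ' / θ)) ^ 2 * θ' ^ (k - i)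
    calc realAnalyticConst c θ B (r / 2) γ * θ ^ (k - i) * (1 + ((k - i : ℕ) : ℝ) * (-Real.log θ)) ^ 2
        = realAnalyticConst c θ B (r / 2) γ * (θ ^ (k - i) * (1 + ((k - i : ℕ) : ℝ) * (-Real.log θ)) ^ 2) := by ring
      _ ≤ realAnalyticConst c θ B (r / 2) γ * (max 1 (2 * (-Real.log θ) / Real.log (θ' / θ)) ^ 2 * θ' ^ (k - i)) :=
          mul_le_mul_of_nonneg_left key hK
      _ = _ := by ring

/-- **THE SAME FROM A TAYLOR MAJORANT** (purely real hypotheses: NE4 + `TaylorMajorant B γ r β`): `HistLipschitz ∧ ∀ θ′ > θ, FadingMemory`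
with the constants of `LocalAnalytic (2B) γ (r∕2)`, i.e. `realAnalyticModuli c θ (2B) (r∕4) γ`. [folklore] -/
theorem histLipschitz_fadingMemory_of_taylorMajorant {β : HBeta} {c θ γ r B : ℝ} (hT : TaylorMajorant B γ r β)
    (hS : ScaleShiftRate c θ γ β) (hc : 0 ≤ c) (hθ0 : 0 < θ) (hθ1 : θ < 1) (hB : 0 < B) (hr : 0 < r) (hγ : 0 < γ) :
    HistLipschitz (realAnalyticModuli c θ (2 * B) (r / 2 / 2) γ) γ β ∧
      ∀ θ', θ < θ' → FadingMemory (realAnalyticFading c θ (2 * B) (r / 2 / 2) γ θ') θ'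
        (realAnalyticModuli c θ (2 * B) (r / 2 / 2) γ) :=
  histLipschitz_fadingMemory_of_localAnalytic (localAnalytic_of_taylorMajorant hT hr) hS hc hθ0 hθ1 (by linarith)
    (by linarith) hγ

/-! ## §5 Node U2 from {real NE4, local analyticity of the real sections} at any rate `θ′ ∈ ]θ,1[` -/

/-- **NODE U2 FROM THE REAL NE4 + LOCAL ANALYTICITY (β-generic, two radii), AT ANY RATE `θ′ ∈ ]θ,1[`** — as `disc_le_of_realAnalytic`, with
`LocalAnalytic B γᵤ r β` in place of {`ExtendsC`, `CoordAnalyticC`}: two IR-pinned runs of (0.20) in `]0,γ]`, `γ ≤ γᵤ`, the AF weight bound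
`Σ(g^A_i)²g^B_{i+1} ≤ U` and the window `C₂(θ′)·U ≤ (1−θ′)∕2` give the GEOMETRIC, K-UNIFORM matching
`|1∕(g^A_j)² − 1∕(g^B_{j+1})²| ≤ (2c∕(1−θ′))·θ′^j`, `j ≤ K`. [cite: Balaban1987RG1, (0.20) p.256 and §1 p.264] -/
theorem disc_le_of_localAnalytic {β : HBeta} {c θ θ' γ γu r B U : ℝ} {K : ℕ} {gA gB : ℕ → ℝ}
    (hL : LocalAnalytic B γu r β) (hS : ScaleShiftRate c θ γu β) (hc : 0 ≤ c) (hθ0 : 0 < θ) (hθ1 : θ < 1)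
    (hB : 0 < B) (hr : 0 < r) (hγu : 0 < γu) (hγle : γ ≤ γu) (hθθ' : θ < θ') (hθ'1 : θ' < 1)
    (hAr : RGEqH K β gA) (hBr : RGEqH (K + 1) β gB)
    (hAbox : ∀ i, i ≤ K → 0 < gA i ∧ gA i ≤ γ) (hBbox : ∀ i, i ≤ K + 1 → 0 < gB i ∧ gB i ≤ γ) (hpin : gA K = gB (K + 1))
    (hU : ∑ i ∈ Finset.range (K + 1), (gA i) ^ 2 * gB (i + 1) ≤ U)
    (hsmall : realAnalyticFading c θ B (r / 2) γu θ' * U ≤ (1 - θ') / 2) :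
    ∀ j, j ≤ K → disc gA gB j ≤ 2 * c / (1 - θ') * θ' ^ j := by
  obtain ⟨hHL, hF⟩ := histLipschitz_fadingMemory_of_localAnalytic hL hS hc hθ0 hθ1 hB hr hγu
  have hθ'0 : 0 < θ' := hθ0.trans hθθ'
  have hS' := T4BetaReadOut.scaleShiftRate_mono hc hθ0.le hθθ'.le hS
  exact disc_le_of_fadingMemory hθ'0 hθ'1 hc (realAnalyticFading_nonneg hc hθ0 hθ1 (by linarith) hγu θ') hAr hBr hAbox
    hBbox hpin (fun k w hw => hS' k w (box_mono hγle (k + 1) hw))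
    (fun k p q hp hq => hHL k p q (box_mono hγle k hp) (box_mono hγle k hq)) (hF θ' hθθ') hU hsmall

variable {F : T4Family} {G : Type u} [GaugeGroup G] [MeasurableSpace G] [HaarData G]

/-- **ON THE DATA: NODE U2's INPUT TRIPLE FROM NE4 FOR THE DATA + LOCAL ANALYTICITY OF ITS REAL SECTIONS, AT ANY RATE `θ′ > θ`** —
`NE4OnData D c θ γᵤ` (real, as typed) + `LocalAnalytic B γᵤ r D.βfun` ⟹ `U2Inputs D c C₂(θ′) θ′ γᵤ Λ₂`; no complex family. [folklore] -/
theorem u2Inputs_of_localAnalytic (D : FiniteEpsData F G) {c θ θ' γu r B : ℝ} (hL : LocalAnalytic B γu r D.βfun)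
    (hN : NE4OnData D c θ γu) (hc : 0 ≤ c) (hθ0 : 0 < θ) (hθ1 : θ < 1) (hB : 0 < B) (hr : 0 < r) (hγu : 0 < γu)
    (hθθ' : θ < θ') :
    U2Inputs D c (realAnalyticFading c θ B (r / 2) γu θ') θ' γu (realAnalyticModuli c θ B (r / 2) γu) := by
  obtain ⟨hHL, hF⟩ := histLipschitz_fadingMemory_of_localAnalytic hL hN hc hθ0 hθ1 hB hr hγu
  exact ⟨T4BetaReadOut.scaleShiftRate_mono hc hθ0.le hθθ'.le hN, hHL, hF θ' hθθ'⟩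

/-- **NO WINDOW BINDER — NODE U2's OUTPUT UNDER THE TARGETS' PREFIX** (cf. `u2Output_under_of_realAnalytic`): with `LocalAnalytic B γᵤ r D.βfun`,
NE4 for the data and the AF binders on ONE hypothesis box `]0,γᵤ]` and a rate `θ′ ∈ ]θ,1[`, `U2Output D g₀ (2c∕(1−θ′)) θ′` holds for EVERY
run box `γ ≤ γ₀ := min(γᵤ, 1, ((1−θ′)∕2)∕((C₂(θ′)+1)((k₀+1)+2∕b)))`, every `g`, every tuned `g₀`; two radii. [folklore] -/
theorem u2Output_under_of_localAnalytic (D : FiniteEpsData F G) {Hβ : Prop} {c θ θ' γu r B b β' : ℝ} {k₀ : ℕ}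
    (hL : LocalAnalytic B γu r D.βfun) (hN : NE4OnData D c θ γu) (hc : 0 ≤ c) (hθ0 : 0 < θ) (hθ1 : θ < 1)
    (hB : 0 < B) (hr : 0 < r) (hγu : 0 < γu) (hθθ' : θ < θ') (hθ'1 : θ' < 1) (hb : 0 < b)
    (hlo : EventualLowerH b γu k₀ D.βfun) (hhi : BetaUpperH β' γu D.βfun) (hγβ : γu ^ 2 * β' < 1) :
    D.UnderHypotheses Hβ fun g₀ => U2Output D g₀ (2 * c / (1 - θ')) θ' := by
  intro _ _
  have hr2 : 0 < r / 2 := by linarith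
  set C₁ : ℝ := realAnalyticFading c θ B (r / 2) γu θ' with hC₁
  have hC : 0 ≤ C₁ := realAnalyticFading_nonneg hc hθ0 hθ1 hr2 hγu θ'
  have hW : 0 < (1 - θ') / 2 := by linarith
  set γ₀ : ℝ := min γu (min 1 ((1 - θ') / 2 / ((C₁ + 1) * (((k₀ : ℝ) + 1) + 2 / b)))) with hγ₀
  have hγ₀pos : 0 < γ₀ := lt_min hγu (lt_min one_pos (by positivity))
  refine ⟨γ₀, hγ₀pos, fun γ hγ hγle => ⟨1, one_pos, fun g _ _ g₀ ht => ?_⟩⟩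
  have hγu' : γ ≤ γu := hγle.trans (min_le_left _ _)
  have hγ1 : γ ≤ 1 := hγle.trans ((min_le_right _ _).trans (min_le_left _ _))
  have hγW : γ ≤ (1 - θ') / 2 / ((C₁ + 1) * (((k₀ : ℝ) + 1) + 2 / b)) :=
    hγle.trans ((min_le_right _ _).trans (min_le_right _ _))
  have hsmall := window_of_small_box (k₀ := k₀) hC hb hW hγ.le hγ1 hγW
  exact u2Output_of_u2Inputs D ((u2Inputs_of_localAnalytic D hL hN hc hθ0 hθ1 hB hr hγu hθθ').mono hγu') hγ hb
    (hθ0.trans hθθ') hθ'1 hc hC (fun k v hk hv => hlo k v hk (box_mono hγu' k hv))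
    (fun k v hv => hhi k v (box_mono hγu' k hv)) (sq_mul_lt_one_mono hγ hγu' hγβ) ht hsmall

/-- **UPSTREAM: NODE U2's TRIPLE ON THE DATA FROM NE5 + (R) + LOCAL ANALYTICITY, AT ANY RATE `θ′ > θ`** (cf. `u2Inputs_of_ne5_realAnalytic`):
NE4 for the data from NE5 for every unpaired coupling + the covariant read-out (`T4BetaReadOutLipschitz.scaleShiftRate_of_ne5_on`, BY NAME);
both history companions from `LocalAnalytic B γᵤ r D.βfun`.  No NE9, no U3 fading memory, no complex family, no complex NE4∕NE5. [folklore] -/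
theorem u2Inputs_of_ne5_localAnalytic (D : FiniteEpsData F G) {C : T4OutputRate.Carriers} {W : Set (ℕ → ℝ)}
    {EA : T4OutputRate.Functional C C.BgA} {EB : ℝ → T4OutputRate.Functional C C.BgB}
    {𝒜A : Set (T4BetaReadOut.Slice C C.BgA)} {𝒜B : Set (T4BetaReadOut.Slice C C.BgB)} {rA : T4BetaReadOut.ReadOut C C.BgA}
    {rB : T4BetaReadOut.ReadOut C C.BgB} {γu κ θ θ' C₅ cr r B : ℝ}
    (hW : ∀ k (v : Fin (k + 1) → ℝ), v ∈ Box γu k → T4FlagMemory.extd v ∈ W)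
    (h5 : ∀ b, 0 < b → b ≤ γu → T4OutputRate.NE5 EA (EB b) W κ θ C₅) (hA : T4BetaReadOut.RepresentsA EA rA γu D.βfun)
    (hB : T4BetaReadOut.RepresentsB EB rB γu D.βfun) (h𝒜A : ∀ g ∈ W, EA g ∈ 𝒜A)
    (h𝒜B : ∀ b, 0 < b → b ≤ γu → ∀ g ∈ W, EB b g ∈ 𝒜B) (hcov : T4BetaReadOutLipschitz.ReadCovariantOn 𝒜A 𝒜B rA rB κ cr)
    (hcr : 0 ≤ cr) (hC₅ : 0 ≤ C₅) (hθ0 : 0 < θ) (hθ1 : θ < 1) (hL : LocalAnalytic B γu r D.βfun) (hBpos : 0 < B)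
    (hr : 0 < r) (hγu : 0 < γu) (hθθ' : θ < θ') :
    U2Inputs D (cr * C₅ * θ) (realAnalyticFading (cr * C₅ * θ) θ B (r / 2) γu θ') θ' γu
      (realAnalyticModuli (cr * C₅ * θ) θ B (r / 2) γu) :=
  u2Inputs_of_localAnalytic D hL (T4BetaReadOutLipschitz.scaleShiftRate_of_ne5_on hW h5 hA hB h𝒜A h𝒜B hcov)
    (mul_nonneg (mul_nonneg hcr hC₅) hθ0.le) hθ0 hθ1 hBpos hr hγu hθθ'

/-- **END TO END: NODE U2's OUTPUT UNDER THE TARGETS' PREFIX ⇐ NE5 + (R) + LOCAL ANALYTICITY OF THE REAL SECTIONS + THE AF BINDERS** — row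
NE4's «DEPENDENT» status at node U2 with the fewest β-side inputs and NO posited complex object: `U2Output D g₀ (2·cr·C₅·θ∕(1−θ′)) θ′` for every
run box `γ ≤ γ₀`, every `g`, every tuned `g₀`.  Every input UNPRINTED except TYPES. [folklore] -/
theorem u2Output_under_of_ne5_localAnalytic (D : FiniteEpsData F G) {Hβ : Prop} {C : T4OutputRate.Carriers} {W : Set (ℕ → ℝ)}
    {EA : T4OutputRate.Functional C C.BgA} {EB : ℝ → T4OutputRate.Functional C C.BgB}
    {𝒜A : Set (T4BetaReadOut.Slice C C.BgA)} {𝒜B : Set (T4BetaReadOut.Slice C C.BgB)} {rA : T4BetaReadOut.ReadOut C C.BgA}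
    {rB : T4BetaReadOut.ReadOut C C.BgB} {γu κ θ θ' C₅ cr r B b β' : ℝ} {k₀ : ℕ}
    (hW : ∀ k (v : Fin (k + 1) → ℝ), v ∈ Box γu k → T4FlagMemory.extd v ∈ W)
    (h5 : ∀ b, 0 < b → b ≤ γu → T4OutputRate.NE5 EA (EB b) W κ θ C₅) (hA : T4BetaReadOut.RepresentsA EA rA γu D.βfun)
    (hB : T4BetaReadOut.RepresentsB EB rB γu D.βfun) (h𝒜A : ∀ g ∈ W, EA g ∈ 𝒜A)
    (h𝒜B : ∀ b, 0 < b → b ≤ γu → ∀ g ∈ W, EB b g ∈ 𝒜B) (hcov : T4BetaReadOutLipschitz.ReadCovariantOn 𝒜A 𝒜B rA rB κ cr)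
    (hcr : 0 ≤ cr) (hC₅ : 0 ≤ C₅) (hθ0 : 0 < θ) (hθ1 : θ < 1) (hL : LocalAnalytic B γu r D.βfun) (hBpos : 0 < B)
    (hr : 0 < r) (hγu : 0 < γu) (hθθ' : θ < θ') (hθ'1 : θ' < 1) (hb : 0 < b) (hlo : EventualLowerH b γu k₀ D.βfun)
    (hhi : BetaUpperH β' γu D.βfun) (hγβ : γu ^ 2 * β' < 1) :
    D.UnderHypotheses Hβ fun g₀ => U2Output D g₀ (2 * (cr * C₅ * θ) / (1 - θ')) θ' :=
  u2Output_under_of_localAnalytic D hL (T4BetaReadOutLipschitz.scaleShiftRate_of_ne5_on hW h5 hA hB h𝒜A h𝒜B hcov)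
    (mul_nonneg (mul_nonneg hcr hC₅) hθ0.le) hθ0 hθ1 hBpos hr hγu hθθ' hθ'1 hb hlo hhi hγβ

end Summit.QuantumFields.BalabanUV.T4Continuum.Spine.NE4

end
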